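import Literature.Analysis.FluidPDE.TaoCascadeDuhamel
import Literature.Analysis.FluidPDE.TaoCascadeMotion
import Literature.Analysis.FunctionSpaces.PlancherelL1L2
import Literature.Analysis.FunctionSpaces.FourierSobolevNormEmbeddingProofs
import HarnessLib

/-!
# `PerpetualPump.PumpTransfer` (stmt-NavierStokesRegularity-1837), line `Sketch`, stub `stub_linfty_of_bandField`

Registered stub of the lead's skeleton `Cruxes/PumpTransfer/Lines/Sketch.lean` (lead prover
prover-line-stmt-NavierStokesRegularity-1837-0). `L^∞` bound of a band-structured field by the weighted fibre sum (`𝓕⁻¹ : L¹ → L^∞`).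

Vocabulary: Tao's cascade operator (4.1) with wavelet data `𝒟 : CascadeWaveletData ε₀ m`
(`Literature/Analysis/FluidPDE/TaoCascadeOperator.lean`), the heat fibres `duhamelScalar δ Qr L t`,
weights `modeWeight 𝒟 i n = |ψ̂_{i,n}|²` and `modeDelta` (`TaoCascadeDuhamel.lean`), `heatRate ξ = 4π²|ξ|²`
(`TaoBandHeatGroup.lean`), the circuit nonlinearity `TaoCascade.quadTerm` (`TaoCascadeODE.lean`).

## The argument

* `eLpNorm_top_le_lintegral_fourierFn`: `‖v‖_{L^∞} ≤ ∫ |v̂|` for every `v ∈ L²(ℝ³; ℂ³)`: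
  `v = 𝓕⁻(𝓕 v)` on `L²`, the `L²` inverse Fourier transform agrees a.e. with the inverse Fourier
  *integral* on `L¹ ∩ L²` and `|𝓕⁻ g(x)| ≤ ∫ |g|` (the tree's
  `Literature.Analysis.FunctionSpaces.SobolevEmbeddingHalf.enorm_fourierInv_toLp_le`,
  `FourierSobolevNormEmbeddingProofs.lean`).
* `lintegral_enorm_fourierFn_cascadeWavelet`: `∫ |ψ̂_{i,n}| = (1+ε₀)^{3n/2} ∫ |ψ̂_i|` (scaling
  `fourierFn_cascadeWavelet` and the substitution `ξ = (1+ε₀)ⁿ η`), and `∫ |ψ̂_i| < ∞` (the Fourier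
  transform of a Schwartz map is Schwartz); `K := ∑ᵢ ∫ |ψ̂_i|`.
* In `stub_linfty_of_bandField`: a.e. in `ξ` at most one term of the band sum
  `v̂(ξ) = ∑_p c_p(ξ) ψ̂_p(ξ)` is nonzero (disjoint frequency regions,
  `CascadeWaveletData.not_mem_freqRegion_of_ne`, `fourierFn_cascadeWavelet_eq_zero`), and where
  `ψ̂_p(ξ) ≠ 0` the weight `|ψ̂_p(ξ)|²` is nonzero so `|c_p(ξ)| ≤ B_p`; hence
  `|v̂(ξ)| ≤ ∑_p B_p |ψ̂_p(ξ)|` a.e., and integrating (`lintegral_tsum`)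
  `∫ |v̂| ≤ ∑_p B_p (1+ε₀)^{3n/2} K`.

## References

* T. Tao, J. Amer. Math. Soc. 29 (2016), 601–674 = arXiv:1402.0290v3, §4 Lemma 4.1 (4.14). [`Tao2016AveragedNS`]
-/

noncomputable section

-- the nested summit namespace is the tree's layout (D-0017)
set_option linter.dupNamespace false

namespace Summit.NavierStokesRegularity.NavierStokesRegularity.Theorems.PerpetualPumpPumpTransfer

open MeasureTheory Set Filter Topology FourierTransform
open scoped ENNReal SchwartzMap
open Literature.Analysis Literature.Analysis.FluidPDE Literature.Analysis.FluidPDE.Tao2016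

/-! ### `L^∞ ≤ L¹` of the Fourier transform, and the `L¹` norms of the wavelets -/

/-- **`‖v‖_{L^∞} ≤ ∫ |v̂|`** for `v ∈ L²(ℝ³; ℂ³)` (in `ℝ≥0∞`, no finiteness hypothesis): if
`v̂ ∈ L¹` then `v = 𝓕⁻¹(𝓕 v)` (`fourierInv_fourier_eq` on `L²`) is a.e. the inverse Fourier integral of
`v̂`, bounded by `∫ |v̂|` (the tree's `SobolevEmbeddingHalf.enorm_fourierInv_toLp_le`). [folklore] -/
theorem eLpNorm_top_le_lintegral_fourierFn (v : L2C) :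
    eLpNorm (v : EuclideanSpace ℝ (Fin 3) → EuclideanSpace ℂ (Fin 3)) ⊤ volume ≤
      ∫⁻ ξ, ‖fourierFn v ξ‖ₑ := by
  by_cases hfin : ∫⁻ ξ, ‖fourierFn v ξ‖ₑ < ∞
  swap
  · rw [not_lt, top_le_iff] at hfin
    rw [hfin]
    exact le_top
  have hint : Integrable (fourierFn v) volume :=
    ⟨Lp.aestronglyMeasurable (𝓕 v : L2C), hfin⟩
  have h2 : MemLp (fourierFn v) 2 volume := Lp.memLp (𝓕 v : L2C)
  have hto : h2.toLp (fourierFn v) = (𝓕 v : L2C) := Lp.toLp_coeFn _ _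
  have hbound := FunctionSpaces.SobolevEmbeddingHalf.enorm_fourierInv_toLp_le hint h2
  rw [hto, fourierInv_fourier_eq] at hbound
  rw [eLpNorm_exponent_top]
  exact eLpNormEssSup_le_of_ae_enorm_bound hbound

/-- The Fourier transform of a (complexified) real Schwartz field on `ℝ³` is integrable,
`∫ |𝓕ψ| < ∞` (it is the Schwartz map `𝓕 (schwartzC ψ)`). [folklore] -/
theorem lintegral_enorm_fourier_schwartz_lt_top
    (ψ : 𝓢(EuclideanSpace ℝ (Fin 3), EuclideanSpace ℝ (Fin 3))) :
    ∫⁻ ξ, ‖𝓕 (FunctionSpaces.EuclideanSpace.complexify ∘ ⇑ψ) ξ‖ₑ < ∞ := by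
  have h : Integrable (𝓕 (FunctionSpaces.EuclideanSpace.complexify ∘ ⇑ψ)) volume := by
    rw [← coe_schwartzC, ← SchwartzMap.fourier_coe]
    exact (𝓕 (schwartzC ψ)).integrable
  exact h.2

/-- Change of variables `x ↦ R⁻¹ x` (`R > 0`) in a lower Lebesgue integral over `ℝ³`:
`∫ |g(R⁻¹ x)| dx = R³ ∫ |g|`. [folklore] -/
theorem lintegral_enorm_comp_inv_smul (g : EuclideanSpace ℝ (Fin 3) → EuclideanSpace ℂ (Fin 3))
    {R : ℝ} (hR : 0 < R) :
    ∫⁻ x, ‖g (R⁻¹ • x)‖ₑ = ENNReal.ofReal (R ^ 3) * ∫⁻ x, ‖g x‖ₑ := by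
  have hR' : R⁻¹ ≠ 0 := inv_ne_zero hR.ne'
  calc ∫⁻ x, ‖g (R⁻¹ • x)‖ₑ
      = ∫⁻ y, ‖g y‖ₑ ∂(Measure.map (fun x : EuclideanSpace ℝ (Fin 3) => R⁻¹ • x) volume) :=
        (lintegral_map_equiv (fun y => ‖g y‖ₑ)
          (Homeomorph.smul (isUnit_iff_ne_zero.2 hR').unit).toMeasurableEquiv).symm
    _ = ENNReal.ofReal (R ^ 3) * ∫⁻ x, ‖g x‖ₑ := by
        rw [Measure.map_addHaar_smul volume hR', lintegral_smul_measure, inv_pow, inv_inv,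
          finrank_euclideanSpace, Fintype.card_fin, abs_of_pos (pow_pos hR 3), smul_eq_mul]

/-- An `rpow` identity for the wavelet scales: `((1+ε₀)ⁿ)^{3/2} = (1+ε₀)^{3n/2}`. [folklore] -/
theorem zpow_rpow_three_halves {ε₀ : ℝ} (hε : 0 < 1 + ε₀) (n : ℤ) :
    ((1 + ε₀) ^ n) ^ ((3 : ℝ) / 2) = (1 + ε₀) ^ ((3 : ℝ) * (n : ℝ) / 2) := by
  rw [← Real.rpow_intCast _ n, ← Real.rpow_mul hε.le]
  congr 1
  ring

/-- **The `L¹` norm of the Fourier transform of a wavelet**: with `c = (1+ε₀)ⁿ`,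
`∫ |ψ̂_n| = c^{3/2} ∫ |ψ̂|` (from `ψ̂_n(ξ) = c^{3/2} c^{-3} ψ̂(ξ/c)`, `fourierFn_cascadeWavelet`, and the
substitution `ξ = cη`). [cite: Tao2016AveragedNS, Def. 3.1] -/
theorem lintegral_enorm_fourierFn_cascadeWavelet {ε₀ : ℝ} (hε : 0 < 1 + ε₀)
    (ψ : 𝓢(EuclideanSpace ℝ (Fin 3), EuclideanSpace ℝ (Fin 3))) (n : ℤ) :
    ∫⁻ ξ, ‖fourierFn (cascadeWavelet ε₀ ψ n) ξ‖ₑ =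
      ENNReal.ofReal (((1 + ε₀) ^ n) ^ ((3 : ℝ) / 2)) *
        ∫⁻ ξ, ‖𝓕 (FunctionSpaces.EuclideanSpace.complexify ∘ ⇑ψ) ξ‖ₑ := by
  have hc : 0 < (1 + ε₀) ^ n := zpow_pos hε n
  have hA : 0 ≤ ((1 + ε₀) ^ n) ^ ((3 : ℝ) / 2) := Real.rpow_nonneg hc.le _
  have hc3 : 0 < ((1 + ε₀) ^ n) ^ 3 := pow_pos hc 3
  have hae : (fun ξ => ‖fourierFn (cascadeWavelet ε₀ ψ n) ξ‖ₑ) =ᵐ[volume] fun ξ =>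
      ENNReal.ofReal (((1 + ε₀) ^ n) ^ ((3 : ℝ) / 2) * |(((1 + ε₀) ^ n) ^ 3)⁻¹|) *
        ‖𝓕 (FunctionSpaces.EuclideanSpace.complexify ∘ ⇑ψ) (((1 + ε₀) ^ n)⁻¹ • ξ)‖ₑ := by
    filter_upwards [fourierFn_cascadeWavelet hε ψ n] with ξ hξ
    rw [← ofReal_norm (fourierFn (cascadeWavelet ε₀ ψ n) ξ), hξ, norm_smul, norm_smul,
      Complex.norm_real, Real.norm_of_nonneg hA, Real.norm_of_nonneg (abs_nonneg _), ← mul_assoc,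
      ENNReal.ofReal_mul (mul_nonneg hA (abs_nonneg _)), ofReal_norm]
  rw [lintegral_congr_ae hae, lintegral_const_mul' _ _ ENNReal.ofReal_ne_top,
    lintegral_enorm_comp_inv_smul (𝓕 (FunctionSpaces.EuclideanSpace.complexify ∘ ⇑ψ)) hc,
    ← mul_assoc, ← ENNReal.ofReal_mul (mul_nonneg hA (abs_nonneg _))]
  congr 2
  rw [mul_assoc, abs_of_pos (inv_pos.2 hc3), inv_mul_cancel₀ hc3.ne', mul_one]

/-! ### The stub -/

/-- **Stub `stub_linfty_of_bandField`.** `L^∞` bound of a band-structured field by the weighted fibre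
sum (`𝓕⁻¹ : L¹ → L^∞`): if `v̂ = ∑_p c_p ψ̂_p` a.e. (`p = (i,n)`, `ψ_p = ψ_{i,n}` the wavelets of `𝒟`),
with `|c_p(ξ)| ≤ B_p` wherever the weight `|ψ̂_p(ξ)|²` is nonzero and `∑_p (1+ε₀)^{3n/2} B_p < ∞`, then
`‖v‖_{L^∞} ≤ K ∑_p (1+ε₀)^{3n/2} B_p` with `K = K(𝒟) = ∑ᵢ ∫ |ψ̂ᵢ|`. Proof: a.e. at most one band
term survives (disjoint frequency regions), so `|v̂| ≤ ∑_p B_p |ψ̂_p|` a.e.;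
`∫ |ψ̂_{i,n}| = (1+ε₀)^{3n/2} ∫ |ψ̂ᵢ| ≤ (1+ε₀)^{3n/2} K` (`lintegral_enorm_fourierFn_cascadeWavelet`); and
`‖v‖_{L^∞} ≤ ∫ |v̂|` (`eLpNorm_top_le_lintegral_fourierFn`). -/
theorem stub_linfty_of_bandField :
    ∀ (ε₀ : ℝ), 0 < ε₀ → ε₀ < 1 → ∀ (m : ℕ) (𝒟 : CascadeWaveletData ε₀ m),
    ∃ K : ℝ, 0 ≤ K ∧ ∀ (c : Fin m × ℤ → EuclideanSpace ℝ (Fin 3) → ℝ) (B : Fin m × ℤ → ℝ) (v : L2C),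
      (fourierFn v =ᵐ[volume] fun ξ => ∑' p : Fin m × ℤ,
        ((c p ξ : ℝ) : ℂ) • fourierFn (cascadeWavelet ε₀ (𝒟.ψ p.1) p.2) ξ) →
      (∀ (p : Fin m × ℤ) (ξ : EuclideanSpace ℝ (Fin 3)), modeWeight 𝒟 p.1 p.2 ξ ≠ 0 → |c p ξ| ≤ B p) →
      Summable (fun p : Fin m × ℤ => (1 + ε₀) ^ ((3 : ℝ) * (p.2 : ℝ) / 2) * B p) →
      eLpNorm (v : EuclideanSpace ℝ (Fin 3) → EuclideanSpace ℂ (Fin 3)) ⊤ volume ≤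
        ENNReal.ofReal (K * ∑' p : Fin m × ℤ, (1 + ε₀) ^ ((3 : ℝ) * (p.2 : ℝ) / 2) * B p) := by
  intro ε₀ hε₀ _hε₁ m 𝒟
  have hε' : 0 < 1 + ε₀ := by linarith
  -- the constant `K = ∑ᵢ ∫ |ψ̂ᵢ|`
  obtain ⟨K, hK0, hIK⟩ : ∃ K : ℝ, 0 ≤ K ∧ ∀ i : Fin m,
      ∫⁻ ξ, ‖𝓕 (FunctionSpaces.EuclideanSpace.complexify ∘ ⇑(𝒟.ψ i)) ξ‖ₑ ≤ ENNReal.ofReal K := by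
    refine ⟨∑ i : Fin m,
        (∫⁻ ξ, ‖𝓕 (FunctionSpaces.EuclideanSpace.complexify ∘ ⇑(𝒟.ψ i)) ξ‖ₑ).toReal,
      Finset.sum_nonneg fun i _ => ENNReal.toReal_nonneg, fun i => ?_⟩
    rw [← ENNReal.ofReal_toReal (lintegral_enorm_fourier_schwartz_lt_top (𝒟.ψ i)).ne]
    exact ENNReal.ofReal_le_ofReal (Finset.single_le_sum
      (f := fun j : Fin m =>
        (∫⁻ ξ, ‖𝓕 (FunctionSpaces.EuclideanSpace.complexify ∘ ⇑(𝒟.ψ j)) ξ‖ₑ).toReal)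
      (fun j _ => ENNReal.toReal_nonneg) (Finset.mem_univ i))
  refine ⟨K, hK0, ?_⟩
  intro c B v hv hB hsum
  have hw0 : ∀ p : Fin m × ℤ, 0 ≤ (1 + ε₀) ^ ((3 : ℝ) * (p.2 : ℝ) / 2) := fun p =>
    Real.rpow_nonneg hε'.le _
  -- the bounds `B p` are nonnegative (the weight `|ψ̂_p|²` has mass one, so is not identically zero)
  have hBnn : ∀ p : Fin m × ℤ, 0 ≤ B p := by
    intro p
    by_contra hneg
    have h0 : ∀ ξ, modeWeight 𝒟 p.1 p.2 ξ = 0 := fun ξ => by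
      by_contra hξ
      exact hneg ((abs_nonneg _).trans (hB p ξ hξ))
    have h1 := integral_modeWeight (𝒟 := 𝒟) (i := p.1) (n := p.2) hε'
    simp [h0] at h1
  -- `L¹` norms of the wavelets' Fourier transforms: `∫ |ψ̂_{i,n}| ≤ (1+ε₀)^{3n/2} K`
  have hΨint : ∀ p : Fin m × ℤ, ∫⁻ ξ, ‖fourierFn (cascadeWavelet ε₀ (𝒟.ψ p.1) p.2) ξ‖ₑ ≤
      ENNReal.ofReal ((1 + ε₀) ^ ((3 : ℝ) * (p.2 : ℝ) / 2) * K) := fun p => by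
    rw [lintegral_enorm_fourierFn_cascadeWavelet hε' (𝒟.ψ p.1) p.2, zpow_rpow_three_halves hε',
      ENNReal.ofReal_mul (hw0 p)]
    exact mul_le_mul' le_rfl (hIK p.1)
  -- all the wavelets vanish (a.e., simultaneously) off their frequency regions
  have hzero : ∀ᵐ ξ ∂(volume : Measure (EuclideanSpace ℝ (Fin 3))), ∀ p : Fin m × ℤ,
      ξ ∉ freqRegion 𝒟 p.1 p.2 → fourierFn (cascadeWavelet ε₀ (𝒟.ψ p.1) p.2) ξ = 0 :=
    ae_all_iff.2 fun p => 𝒟.fourierFn_cascadeWavelet_eq_zero hε' p.1 p.2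
  -- pointwise: a.e. at most one band term survives, so `|v̂(ξ)| ≤ ∑_p B_p |ψ̂_p(ξ)|`
  have hpt : ∀ᵐ ξ ∂(volume : Measure (EuclideanSpace ℝ (Fin 3))),
      ‖fourierFn v ξ‖ₑ ≤ ∑' p : Fin m × ℤ,
        ENNReal.ofReal (B p) * ‖fourierFn (cascadeWavelet ε₀ (𝒟.ψ p.1) p.2) ξ‖ₑ := by
    filter_upwards [hv, hzero] with ξ h1 h2
    rw [h1]
    by_cases hex : ∃ p₀ : Fin m × ℤ, ξ ∈ freqRegion 𝒟 p₀.1 p₀.2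
    · obtain ⟨p₀, hp₀⟩ := hex
      have hothers : ∀ p : Fin m × ℤ, p ≠ p₀ →
          fourierFn (cascadeWavelet ε₀ (𝒟.ψ p.1) p.2) ξ = 0 := fun p hp =>
        h2 p (𝒟.not_mem_freqRegion_of_ne hε₀ (Ne.symm hp) hp₀)
      rw [tsum_eq_single p₀ (fun p hp => ?_)]
      · by_cases hz : fourierFn (cascadeWavelet ε₀ (𝒟.ψ p₀.1) p₀.2) ξ = 0
        · rw [hz, smul_zero, enorm_zero]
          exact zero_le
        · have hwt : modeWeight 𝒟 p₀.1 p₀.2 ξ ≠ 0 := by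
            unfold modeWeight
            exact pow_ne_zero 2 (norm_ne_zero_iff.2 hz)
          have hcB := hB p₀ ξ hwt
          calc ‖((c p₀ ξ : ℝ) : ℂ) • fourierFn (cascadeWavelet ε₀ (𝒟.ψ p₀.1) p₀.2) ξ‖ₑ
              = ENNReal.ofReal (|c p₀ ξ| * ‖fourierFn (cascadeWavelet ε₀ (𝒟.ψ p₀.1) p₀.2) ξ‖) := by
                rw [← ofReal_norm, norm_smul, Complex.norm_real, Real.norm_eq_abs]
            _ ≤ ENNReal.ofReal (B p₀ * ‖fourierFn (cascadeWavelet ε₀ (𝒟.ψ p₀.1) p₀.2) ξ‖) :=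
                ENNReal.ofReal_le_ofReal (mul_le_mul_of_nonneg_right hcB (norm_nonneg _))
            _ = ENNReal.ofReal (B p₀) * ‖fourierFn (cascadeWavelet ε₀ (𝒟.ψ p₀.1) p₀.2) ξ‖ₑ := by
                rw [ENNReal.ofReal_mul (hBnn _), ofReal_norm]
            _ ≤ ∑' p : Fin m × ℤ,
                  ENNReal.ofReal (B p) * ‖fourierFn (cascadeWavelet ε₀ (𝒟.ψ p.1) p.2) ξ‖ₑ :=
                ENNReal.le_tsum p₀
      · rw [hothers p hp, smul_zero]
    · have hall : ∀ p : Fin m × ℤ, fourierFn (cascadeWavelet ε₀ (𝒟.ψ p.1) p.2) ξ = 0 :=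
        fun p => h2 p fun h => hex ⟨p, h⟩
      simp [hall]
  -- integrate: `∫ |v̂| ≤ ∑_p B_p ∫ |ψ̂_p| ≤ K ∑_p (1+ε₀)^{3n/2} B_p`
  have hmeas : ∀ p : Fin m × ℤ,
      AEMeasurable (fun ξ => ‖fourierFn (cascadeWavelet ε₀ (𝒟.ψ p.1) p.2) ξ‖ₑ) volume :=
    fun p => (Lp.aestronglyMeasurable _).aemeasurable.enorm
  have hL1 : ∫⁻ ξ, ‖fourierFn v ξ‖ₑ ≤
      ENNReal.ofReal (K * ∑' p : Fin m × ℤ, (1 + ε₀) ^ ((3 : ℝ) * (p.2 : ℝ) / 2) * B p) := by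
    calc ∫⁻ ξ, ‖fourierFn v ξ‖ₑ
        ≤ ∫⁻ ξ, ∑' p : Fin m × ℤ,
            ENNReal.ofReal (B p) * ‖fourierFn (cascadeWavelet ε₀ (𝒟.ψ p.1) p.2) ξ‖ₑ :=
          lintegral_mono_ae hpt
      _ = ∑' p : Fin m × ℤ,
            ∫⁻ ξ, ENNReal.ofReal (B p) * ‖fourierFn (cascadeWavelet ε₀ (𝒟.ψ p.1) p.2) ξ‖ₑ :=
          lintegral_tsum fun p => (hmeas p).const_mul _
      _ = ∑' p : Fin m × ℤ,
            ENNReal.ofReal (B p) * ∫⁻ ξ, ‖fourierFn (cascadeWavelet ε₀ (𝒟.ψ p.1) p.2) ξ‖ₑ := by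
          congr 1
          funext p
          rw [lintegral_const_mul'' _ (hmeas p)]
      _ ≤ ∑' p : Fin m × ℤ,
            ENNReal.ofReal (B p) * ENNReal.ofReal ((1 + ε₀) ^ ((3 : ℝ) * (p.2 : ℝ) / 2) * K) :=
          ENNReal.tsum_le_tsum fun p => mul_le_mul' le_rfl (hΨint p)
      _ = ∑' p : Fin m × ℤ,
            ENNReal.ofReal (K * ((1 + ε₀) ^ ((3 : ℝ) * (p.2 : ℝ) / 2) * B p)) := by
          congr 1
          funext p
          rw [← ENNReal.ofReal_mul (hBnn p)]
          congr 1
          ring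
      _ = ENNReal.ofReal (∑' p : Fin m × ℤ, K * ((1 + ε₀) ^ ((3 : ℝ) * (p.2 : ℝ) / 2) * B p)) :=
          (ENNReal.ofReal_tsum_of_nonneg
            (fun p => mul_nonneg hK0 (mul_nonneg (hw0 p) (hBnn p))) (hsum.mul_left K)).symm
      _ = ENNReal.ofReal (K * ∑' p : Fin m × ℤ, (1 + ε₀) ^ ((3 : ℝ) * (p.2 : ℝ) / 2) * B p) := by
          rw [tsum_mul_left]
  exact (eLpNorm_top_le_lintegral_fourierFn v).trans hL1

end Summit.NavierStokesRegularity.NavierStokesRegularity.Theorems.PerpetualPumpPumpTransfer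

end
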